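import Summits.BirchSwinnertonDyer.Rank1Residual.X11b.AnticyclotomicSelmerStructure
import HarnessLib

/-!
# X11b, route R1 — Castella's RELAXED Selmer structure: finiteness from the unrelaxed group and the
# local groups at the relaxed places

HONEST FRAMING (cell `b2b-bsdres`, run/shared/lean/b2b/bsd-rank1-residual/, verbatim in every
file): the goal of the cell is to DELETE the COMBINATION-SHAPED residual classes of the
Birch–Swinnerton-Dyer formula for ALL analytic-rank `≤ 1` elliptic curves over `ℚ` — "full BSD
formula for every rank `≤ 1` curve in class `C`" assembled STRICTLY from published theorems — so
that the rank-`≤ 1` remainder becomes exactly the CONSTRUCTION-SHAPED classes, which are TYPED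
(missing-input `Prop`s), NOT attempted. This is not "finishing BSD". Sub-cell
`b2b-bsdres-multr1-p1` (X11b, route R1 = Castella 2018 Thm. A re-proved along the author's
erratum); a RESEARCH ROUTE; no claim beyond the stated class; X11b stays CONSTRUCTION-SHAPED;
nothing here changes a label; no named fact is minted (one definition with a body — a localisation
homomorphism — and theorems; no `sorry`).

## What is here

For Castella's Selmer structure `𝓛^{ac,Σ}_𝔮 = AcSelmer.acStructure ρ p 𝔮 Σ` (Cas18 Def. 2.2 at
level `K`: strict at `𝔮`, relaxed at the other places above `p` and on `Σ`, trivial elsewhere) on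
any discrete Galois module `ρ` over a number field:

* `AcSelmer.selmerGroup_acStructure_mono`: `Σ ⊆ Σ' ⟹ H¹_{𝓛^{ac,Σ}} ≤ H¹_{𝓛^{ac,Σ'}}`;
* `AcSelmer.locAt` — the localisation `H¹_{𝓛^{ac,Σ}}(K, M) → ∏_{v ∈ Σ, v ∤ p} H¹(K_v, M)`, whose
  kernel lies in `H¹_{𝓛^{ac,∅}}(K, M)` (`mem_selmerGroup_empty_of_locAt_eq_zero`);
* **`AcSelmer.finite_selmerGroup_acStructure_of_finite_empty`**: if `H¹_{𝓛^{ac,∅}_𝔮}(K, M)` is finite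
  and `H¹(K_v, M)` is finite at every `v ∈ Σ` away from `p` (`Σ` finite), then `H¹_{𝓛^{ac,Σ}_𝔮}(K, M)`
  is finite (Mathlib `AddGroup.fintypeOfKerLeRange`).

This is the reduction of hypothesis (vi) of `levelLiftingAt_of_finite` (`LevelLiftingFromFiniteness`:
finiteness of the RELAXED conjugate group) to the finiteness of `Sel_𝔮(K, E[p^∞])` itself (JSW17 /
Castella: the group controlled by the BDP main conjecture; in the cell, multr1-p2's `≤`-half) plus
the finiteness of the finitely many local groups `H¹(K_v, E[p^∞])`, `v ∤ p` (local Euler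
characteristic + Lutz–Mattuck).

References: [Castella2018] Def. 2.2; [JetchevSkinnerWan2017] §2.2.3, Prop. 3.3.2; [GreenbergLNM1716]
§3 (finiteness of the local terms away from `p`).
-/

noncomputable section

open scoped Classical

open Field NumberField IsDedekindDomain
open Literature.NumberTheory.GaloisRepresentations
open Literature.NumberTheory.GaloisRepresentations.DiscreteGaloisModule (SelmerStructure)

universe u

namespace Summit.BirchSwinnertonDyer.Rank1Residual.X11b.AcSelmer

variable {K : Type u} [Field K] [NumberField K] {M : Type u} [AddCommGroup M] [TopologicalSpace M]
  [DiscreteTopology M] (ρ : DiscreteGaloisModule K M) (p : ℕ) (𝔮 : HeightOneSpectrum (𝓞 K))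

/-- `Σ ⊆ Σ' ⟹ H¹_{𝓛^{ac,Σ}}(K, M) ≤ H¹_{𝓛^{ac,Σ'}}(K, M)` (relaxing local conditions enlarges the
Selmer group). [cite: Castella2018, Def. 2.2 (arXiv:1704.06608 p. 5)] -/
theorem selmerGroup_acStructure_mono {S S' : Set (HeightOneSpectrum (𝓞 K))} (h : S ⊆ S') :
    (acStructure ρ p 𝔮 S).selmerGroup ≤ (acStructure ρ p 𝔮 S').selmerGroup := by
  intro c hc
  rw [SelmerStructure.mem_selmerGroup_iff] at hc ⊢
  exact fun v ↦ acStructure_mono ρ p 𝔮 h v (hc v)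

variable (S : Set (HeightOneSpectrum (𝓞 K)))

/-- **Localisation at the relaxed places away from `p`**:
`H¹_{𝓛^{ac,Σ}}(K, M) → ∏_{v ∈ Σ, v ∤ p} H¹(K_v, M)`. [folklore] -/
def locAt : (acStructure ρ p 𝔮 S).selmerGroup →+
    ∀ v : {v : HeightOneSpectrum (𝓞 K) // v ∈ S ∧ ((p : ℕ) : 𝓞 K) ∉ v.asIdeal},
      galoisCohomology (ρ.toLocal (Sum.inr (v : HeightOneSpectrum (𝓞 K)))) 1 :=
  AddMonoidHom.pi fun v ↦
    (galoisCohomology.localization ρ (Sum.inr (v : HeightOneSpectrum (𝓞 K))) 1).comp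
      (acStructure ρ p 𝔮 S).selmerGroup.subtype

/-- Unfolding `locAt`. [folklore] -/
@[simp]
theorem locAt_apply (c : (acStructure ρ p 𝔮 S).selmerGroup)
    (v : {v : HeightOneSpectrum (𝓞 K) // v ∈ S ∧ ((p : ℕ) : 𝓞 K) ∉ v.asIdeal}) :
    locAt ρ p 𝔮 S c v =
      galoisCohomology.localization ρ (Sum.inr (v : HeightOneSpectrum (𝓞 K))) 1 (c : galoisCohomology ρ 1) :=
  rfl

/-- **The kernel of the localisation lies in the unrelaxed group**: a class of `H¹_{𝓛^{ac,Σ}}(K, M)`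
trivial at every `v ∈ Σ` away from `p` lies in `H¹_{𝓛^{ac,∅}}(K, M)` (at the places of `Σ` above `p`
and at `𝔮` the two structures agree). [cite: Castella2018, Def. 2.2 (arXiv:1704.06608 p. 5)] -/
theorem mem_selmerGroup_empty_of_locAt_eq_zero (c : (acStructure ρ p 𝔮 S).selmerGroup)
    (hc : locAt ρ p 𝔮 S c = 0) :
    (c : galoisCohomology ρ 1) ∈ (acStructure ρ p 𝔮 (∅ : Set (HeightOneSpectrum (𝓞 K)))).selmerGroup := by
  have hmem := c.2
  rw [SelmerStructure.mem_selmerGroup_iff] at hmem ⊢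
  intro v
  cases v with
  | inl w => simpa only [acStructure_inl] using hmem (Sum.inl w)
  | inr v =>
    rw [acStructure_inr]
    split_ifs with h
    · rcases h with rfl | ⟨hpv, -⟩
      · have h𝔮 := hmem (Sum.inr v)
        rwa [acStructure_self] at h𝔮
      · by_cases hvS : v ∈ S
        · have h0 := congrFun hc ⟨v, hvS, hpv⟩
          rw [locAt_apply] at h0
          rw [AddSubgroup.mem_bot]
          exact h0
        · have hv := hmem (Sum.inr v)
          rwa [acStructure_of_not_mem ρ p 𝔮 S hpv hvS] at hv
    · exact AddSubgroup.mem_top _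

/-- **Finiteness of the relaxed group.** If `H¹_{𝓛^{ac,∅}_𝔮}(K, M)` is finite, `Σ` is finite, and
`H¹(K_v, M)` is finite at every `v ∈ Σ` away from `p`, then `H¹_{𝓛^{ac,Σ}_𝔮}(K, M)` is finite:
its localisation to `∏_{v ∈ Σ, v ∤ p} H¹(K_v, M)` has kernel inside the image of the finite
`H¹_{𝓛^{ac,∅}_𝔮}(K, M)` (Mathlib `AddGroup.fintypeOfKerLeRange`).  For `M = E[p^∞]` this reduces the
finiteness input of `levelLiftingAt_of_finite` to `Finite (Sel_𝔮(K, E[p^∞]))` and the finiteness of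
finitely many local groups `H¹(K_v, E[p^∞])`, `v ∤ p` (Greenberg LNM 1716 §3: finite, of order
`#E(K_v)[p^∞]`-controlled). [cite: GreenbergLNM1716, §3 Lemma 3.3 (p. 87)]
[cite: Castella2018, Def. 2.2 (arXiv:1704.06608 p. 5)] -/
theorem finite_selmerGroup_acStructure_of_finite_empty (hS : S.Finite)
    (hfin : Finite (acStructure ρ p 𝔮 (∅ : Set (HeightOneSpectrum (𝓞 K)))).selmerGroup)
    (hloc : ∀ v ∈ S, ((p : ℕ) : 𝓞 K) ∉ v.asIdeal →
      Finite (galoisCohomology (ρ.toLocal (Sum.inr v)) 1)) :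
    Finite (acStructure ρ p 𝔮 S).selmerGroup := by
  haveI : Finite {v : HeightOneSpectrum (𝓞 K) // v ∈ S ∧ ((p : ℕ) : 𝓞 K) ∉ v.asIdeal} :=
    Set.Finite.to_subtype (hS.subset fun v hv ↦ hv.1)
  haveI : ∀ v : {v : HeightOneSpectrum (𝓞 K) // v ∈ S ∧ ((p : ℕ) : 𝓞 K) ∉ v.asIdeal},
      Finite (galoisCohomology (ρ.toLocal (Sum.inr (v : HeightOneSpectrum (𝓞 K)))) 1) :=
    fun v ↦ hloc v v.2.1 v.2.2
  haveI : Fintype (acStructure ρ p 𝔮 (∅ : Set (HeightOneSpectrum (𝓞 K)))).selmerGroup :=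
    Fintype.ofFinite _
  haveI : Fintype (∀ v : {v : HeightOneSpectrum (𝓞 K) // v ∈ S ∧ ((p : ℕ) : 𝓞 K) ∉ v.asIdeal},
      galoisCohomology (ρ.toLocal (Sum.inr (v : HeightOneSpectrum (𝓞 K)))) 1) := Fintype.ofFinite _
  haveI : Fintype (acStructure ρ p 𝔮 S).selmerGroup :=
    AddGroup.fintypeOfKerLeRange
      (AddSubgroup.inclusion (selmerGroup_acStructure_mono ρ p 𝔮 (Set.empty_subset S)))
      (locAt ρ p 𝔮 S) fun c hc ↦
        ⟨⟨(c : galoisCohomology ρ 1),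
          mem_selmerGroup_empty_of_locAt_eq_zero ρ p 𝔮 S c ((AddMonoidHom.mem_ker).mp hc)⟩, rfl⟩
  exact Finite.of_fintype _

end Summit.BirchSwinnertonDyer.Rank1Residual.X11b.AcSelmer

end
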